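import Literature.MathematicalPhysics.QuantumFieldTheory.Balaban1983to89.B9Eq342TowerFlatBaseMajorants
import Literature.MathematicalPhysics.QuantumFieldTheory.Balaban1983to89.B9Eq358TowerKernelSizes
import Literature.MathematicalPhysics.QuantumFieldTheory.Balaban1983to89.B9Eq360LaplacePrimeAkLaw
import Literature.MathematicalPhysics.QuantumFieldTheory.Balaban1983to89.B9Thm34SectBUniformR1
import Literature.MathematicalPhysics.QuantumFieldTheory.Balaban1983to89.B9Ineq363Vprime
import Literature.MathematicalPhysics.QuantumFieldTheory.Balaban1983to89.B9Ineq385KernelConcrete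

/-!
# `Balaban1983to89.B9Thm34TowerVacuumLadder` — T. Bałaban, *Propagators for lattice gauge theories in a background field*, Commun. Math. Phys. **99** (1985) 389–434
# [Balaban1985BackgroundPropagators] Thm 3.4 p. 400 with (3.60)–(3.65) pp. 402–403 («They satisfy Theorem 3.1 with the additional small factor O(1)α₁», p. 403), Thm 3.1 (3.42) p. 397:
# **THE TWO-BACKGROUND LADDER FOR THE NE9 CHAIN's `k`-LEVEL SITE PROPAGATOR, LATTICE-UNIFORMLY: `G′_k(U) − G′_k(1)` HAS A BLOCK MAJORANT WITH THE SMALL FACTOR `θ₃₆₃(4α) = O(1)·α`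
# AND CONSTANTS CHOSEN BEFORE THE LATTICE** — the CAPSTONE of junction items (j1)–(j6) of the NE9 lineage's route memo `ROUTE-J-VIA-THM34-g98.md`: lit-balaban r06's Sect. B
# programme `B9Thm34SectBUniformR1.thm34_Gp_uniform` (Thm 3.4 ⇐ Thm 3.1 at the base, block-majorant form) INSTANTIATED at the chain's objects — base `U₀ ≡ 1`, exponent field
# `A = (iη)⁻¹log U` (print's left chart), geometry `towerGeom`, block map `blkK`, letters `k_Q, s_Q, k_F, s_F, a′` of this lineage, the three Thm-3.1 inputs = the chain's own rows
# at the vacuum — then (3.65) `G′(U) − G′(1) = G′(U)V′(A)G′(1)`, (3.63) for the concrete `V′(A)` (`B9Ineq363Vprime.ineq363_op_vPrime`) and [4] (2.66) (`majorant_G0_mul_265`)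

statement-level skeleton of published theorems with citation tags; proofs where landed; nothing here is a claim about the Yang–Mills mass gap

CITATION HEADER (lean-in-tree rule).  Audit cell `pub-balaban`, sub-cell `t4`, BINDER row NE9; NE9 crux-team LEAF PROVER 01 (`b2b-balaban-t4-ne9-formalise-leaf-01`,
gen 99; bears_on: R4/N22).  Vocabulary BY NAME: r06's `B9Thm34SectBUniformR1.thm34_Gp_uniform`, `B9Ineq363Vprime.ineq363_op_vPrime` ∕ `theta363`,
`B9Ineq385KernelConcrete.eq386_resolvent_of_inverses`, `B9Eq360Vprime.gPrimeExtEnd`, `B9Eq360VprimeLetters.vPrimeConc`, `B9Eq352DivFormLetters.conj`; pv08's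
`B6RandomWalk.majorant_G0_mul_265` ∕ `hasMajorant_mono` ∕ `hasMajorant_sub`?—(differences are written as products here, no subtraction lemma is used); this lineage's
`B9Eq341TowerBlockGeometry` (j1), `B9Eq357QprimeTowerKernelForm` ∕ `B9Eq324PenaltyKernelForm` ∕ `B9Eq358TowerKernelSizes` (letters and their sizes), `B9Eq360LaplacePrimeAkLaw` (the (3.60) law,
realified; inverse pair; uniqueness), `B9Eq342TowerFlatBaseMajorants` (the three Thm-3.1 inputs at the vacuum), g98's `B9Eq337LogChartFlatBase` ((3.37) for the log chart), the chain's
`B9Eq324DeltaPrimeATower.GpOfUk` ∕ `laplacePrimeAk`.  Sources read through those files' verbatim quotations: [Balaban1985BackgroundPropagators] pp. 397, 400, 402–403;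
[Balaban1984PropagatorsII] Lemma 2.1 p. 234, (2.66).  [folklore] COMPOSITION BY NAME; NOTHING of print's proofs is reproduced beyond what the named files prove.

WHAT IS PROVED (sorry-free; proof lane — no `def`).
* `theta363_le_linear` — `θ₃₆₃(α₁) ≤ Θ(α₁⁰)·α₁` for `0 ≤ α₁ ≤ α₁⁰` (the «O(1)α₁»).
* **`exists_hasMajorant_GpOfUk_sub_flat`** — `∃ α_J, B_J, δ_J > 0` BEFORE the lattice such that, at every height `n` on print's diagonal `ηL^{n+1} = 1`, `c₀(L^{n+1})^d = c₁`, every period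
  `m`, every background `U` with `U(b) ∈ U1`, `‖U(b) − 1‖ ≤ αη`, the ALL-DIRECTION nearest-neighbour window `‖U_μ(x + e_ν) − U_μ(x)‖ ≤ αη²` (print's (3.35)), level averages
  `‖Ū^j(b) − 1‖ ≤ ε_j ≤ αr^j` in `U1` (`α ≤ α_J`), ANY positivity witnesses of `Δ′_{a′,k}(U)`, `Δ′_{a′,k}(1)`, ANY `M, R_r, H`:
  `HasMajorant (toB6 (towerGeom …) R_r H) (fun p => blkK p.1) (conj b (readA φ G′_k(U)) − conj b (readA φ G′_k(1))) (fun a a′ => B_J·α·e^{−δ_J·d(a,a′)})` — the difference of the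
  `k`-level site propagators at `U` and at the vacuum is `O(α)` with exponential block decay, constants free of `n, η, m, U`.
HONEST SCOPE.  Composition BY NAME; constants crude (NOT print's); the Thm-3.1 inputs are the cell's MODEL rows («NE9 ⇐ the named binders»; O-NE9-1, #5 UNRULED); the read-back into the
chain's `W`-valued sup rows is `B9Eq342MajorantReadingSeam.blockRowW_of_hasMajorant_conj_readA` (one line, not restated); the bond-operator members of Thm 3.4 (`G`, `(Q′G′²Q′*)⁻¹`, `R`)
are NOT here; NE9 NOT PRINTED ∕ NOT PROVED; spine PROVED 0∕9; rung (B)+1 finite T⁴ — NOT infinite volume, NOT mass gap, NOT BetaPertH, NOT Clay.  HONEST DEPENDENCY: continuum YM on T⁴ ⇐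
BetaPertH ∧ nine spine estimates (0/9 proved); BetaPertH ⇐ (D1) ∧ (D4) ∧ CAP+tail; G-an2-4 gates asym, D1 and NE2/3/4.  NEW file; nothing modified.  Net new unproved facts: 0.
-/

noncomputable section

open scoped BigOperators InnerProductSpace

namespace Literature.MathematicalPhysics.QuantumFieldTheory.Balaban1983to89.B9Thm34TowerVacuumLadder

open Complex (I)
open B4Sect5Torus (TSite)
open B7Prop1Explicit (U1)
open B9SectCLatticeCarrier (Bond shift)
open B9Eq311L2Pairing (WL2)
open B11Eq103H1Complex (SiteL2K)
open B9Eq310HessianOperator (adTransportW)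
open B9Eq315QTower (towerP UlevOf)
open B9Eq324DeltaPrimeATower (laplacePrimeAk GpOfUk)
open B6RandomWalk (HasMajorant hasMajorant_mono majorant_G0_mul_265 Ineq261)
open B9Thm34Ext (toB6)
open B9Eq39Adjoint (prodCfg covD covDstar)
open B9Eq352DivForm (tauB)
open B9Eq33CovDerivVector (shiftEquiv adTransport)
open B9Eq352DivFormLetters (conj)
open B9Eq352GradLetters (diffLetter)
open B9Eq360Vprime (gPrimeExtEnd)
open B9Eq360VprimeLetters (vPrimeConc)
open B9Eq324PenaltyKernelForm (readA sQ norm_sQ_one_le)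
open B9Eq357QprimeTowerKernelForm (blkK kQ norm_kQ_le card_block_blkK_mul_inv_eq_one)
open B9Eq341TowerBlockGeometry (towerGeom len_towerGeom dist_towerGeom htri_towerGeom hrefl_towerGeom hsym_towerGeom hdnn_towerGeom hlen_towerGeom hlenη_towerGeom
  h261_towerGeom h261_towerGeom_R1 hST_towerGeom dist_blkK_shift_le dist_blkK_shift_symm_le dist_self_le)
open B9Eq358TowerKernelSizes (kQ_flatLevels_eq norm_kF_le_of_class norm_sF_le_of_class exp_window_sub_one_le)
open B9Eq360LaplacePrimeAkLaw (conj_readA_law conj_readA_GpOfUk_inverse eq_conj_readA_GpOfUk_of_inverse)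
open B9Eq342TowerFlatBaseMajorants (exists_hasMajorants_GpOfUk_one)
open B9Eq337LogChartFlatBase (logChart_bounds_flatBase prodCfg_one_logChart)
open B9Thm34SectBUniformR1 (thm34_Gp_uniform)
open B9Ineq363Vprime (ineq363_op_vPrime theta363 cVConc)
open B9Ineq385KernelConcrete (eq386_resolvent_of_inverses)
open MatrixLog (mlog)

/-! ## §1 «O(1)α₁»: `θ₃₆₃` is linear in `α₁` up to a monotone factor -/

/-- **`θ₃₆₃(α₁) ≤ 2B₀Λc·cVConc(α₁⁰)·α₁` for `0 ≤ α₁ ≤ α₁⁰`** (nonnegative parameters): the «additional small factor O(1)α₁» (p. 403) made a LINEAR bound.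
[cite: Balaban1985BackgroundPropagators, (3.63) p.402, p.403] -/
theorem theta363_le_linear {dκ : ℕ} {ρu α₁ α₁0 a₀ C M₂ Sb E₀ B₀ Λ c : ℝ} (hα₁ : 0 ≤ α₁) (hαα : α₁ ≤ α₁0) (ha₀ : 0 ≤ a₀) (hC : 0 ≤ C) (hM₂ : 0 ≤ M₂)
    (hSb : 0 ≤ Sb) (hE₀ : 0 ≤ E₀) (hB₀ : 0 ≤ B₀) (hΛ : 0 ≤ Λ) (hc : 0 ≤ c) :
    theta363 dκ ρu α₁ a₀ C M₂ Sb E₀ B₀ Λ c ≤ (B₀ * Λ * c * (2 * cVConc dκ ρu α₁0 a₀ C M₂ Sb E₀)) * α₁ := by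
  unfold theta363 B9Ineq385VG.kappa385
  simp only [add_zero]
  refine mul_le_mul_of_nonneg_right (mul_le_mul_of_nonneg_left ?_ (by positivity)) hα₁
  unfold cVConc
  have h1 : (2 + 8 * ρu ^ 2 * α₁) * (dκ : ℝ) ≤ (2 + 8 * ρu ^ 2 * α₁0) * (dκ : ℝ) := by gcongr
  have h2 : a₀ * C * (2 + C * α₁) ≤ a₀ * C * (2 + C * α₁0) := by gcongr
  nlinarith [mul_nonneg (mul_nonneg hM₂ hSb) hE₀, h1, h2]

/-! ## §2 The ladder -/

section Main

variable {d : ℕ} (L : ℕ) [NeZero L] {𝔸 : Type*} [NormedRing 𝔸] [NormedAlgebra ℂ 𝔸] [CompleteSpace 𝔸] [NormOneClass 𝔸] [StarRing 𝔸] [FiniteDimensional ℂ 𝔸]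
  {W : Type*} [NormedAddCommGroup W] [InnerProductSpace ℂ W] [FiniteDimensional ℂ W] (φ : W ≃ₗ[ℂ] 𝔸) {a' Mφ Mφ' : ℝ}
  (hMφ : 0 ≤ Mφ) (hMφ' : 0 ≤ Mφ') (hφn : ∀ w, ‖φ w‖ ≤ Mφ * ‖w‖) (hφn' : ∀ X, ‖φ.symm X‖ ≤ Mφ' * ‖X‖) (ha' : 0 < a')
  {r : ℝ} (hr0 : 0 ≤ r) (hr1 : r < 1)
  (τ : 𝔸 →ₗ[ℂ] ℂ) (hτ₂ : ∀ X Y : 𝔸, τ (X * Y) = τ (Y * X)) (hφτ : ∀ X Y : 𝔸, ⟪φ.symm X, φ.symm Y⟫_ℂ = τ (star X * Y))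
  {ι : Type} [Fintype ι] [DecidableEq ι] (b : Module.Basis ι ℝ 𝔸) {M₂ : ℝ} (hM₂ : 0 ≤ M₂) (hrepr : ∀ (v : 𝔸) (i : ι), |b.repr v i| ≤ M₂ * ‖v‖)

include hMφ hMφ' hφn hφn' ha' hr0 hr1 hτ₂ hφτ hM₂ hrepr in
set_option maxHeartbeats 3200000 in
/-- **THE TWO-BACKGROUND LADDER FOR `G′_k`, LATTICE-UNIFORMLY** — see the module docstring: `conj b (readA φ G′_k(U)) − conj b (readA φ G′_k(1)) ≺ B_J·α·e^{−δ_J d}` over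
`towerGeom`, for every background of print's small-field class (with the all-direction window (3.35)), `α ≤ α_J`, the constants chosen BEFORE `n, η, m, U`.
[cite: Balaban1985BackgroundPropagators, Thm 3.4 p.400, (3.60)–(3.65) pp.402–403, Thm 3.1 (3.42) p.397; Balaban1984PropagatorsII, Lemma 2.1 p.234, (2.66) p.234] -/
theorem exists_hasMajorant_GpOfUk_sub_flat (hd : 1 ≤ d) (hL3 : 3 ≤ L) :
    ∃ αJ BJ δJ : ℝ, 0 < αJ ∧ 0 ≤ BJ ∧ 0 < δJ ∧
      ∀ (n : ℕ) (η : ℝ), η * (L : ℝ) ^ (n + 1) = 1 →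
      ∀ (c₀ c₁ : ℝ) [Fact (0 < c₀)] [Fact (0 < c₁)], c₀ * ((L : ℝ) ^ (n + 1)) ^ d = c₁ →
      ∀ (m : Fin d → ℕ) [∀ i, NeZero (m i)] (U : Bond d (towerP L m (n + 1)) → 𝔸ˣ) (α : ℝ), 0 ≤ α → α ≤ αJ →
        (∀ bd, U bd ∈ U1 𝔸) → (∀ bd, ‖(U bd : 𝔸) - 1‖ ≤ α * η) →
        (∀ (x : TSite d (towerP L m (n + 1))) (μ ν : Fin d), ‖(U (shift ν x, μ) : 𝔸) - (U (x, μ) : 𝔸)‖ ≤ α * η ^ 2) →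
      ∀ (εU : ℕ → ℝ), (∀ j, 0 ≤ εU j) → (∀ j, εU j ≤ 1) → (∀ j < n + 1, εU j ≤ α * r ^ j) →
        (∀ (j : ℕ) (bd : Bond d (towerP L m (j + 1))), ‖(UlevOf L m (n + 1) U j bd : 𝔸) - 1‖ ≤ εU j) →
        (∀ (j : ℕ) (bd : Bond d (towerP L m (j + 1))), UlevOf L m (n + 1) U j bd ∈ U1 𝔸) →
      ∀ (hposU : ∀ x : SiteL2K ℂ d (towerP L m (n + 1)) c₀ W, x ≠ 0 → 0 < RCLike.re ⟪x, laplacePrimeAk L m n φ η U a' (c₁ := c₁) x⟫_ℂ)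
        (hpos₁ : ∀ x : SiteL2K ℂ d (towerP L m (n + 1)) c₀ W, x ≠ 0 →
          0 < RCLike.re ⟪x, laplacePrimeAk L m n φ η (fun _ : Bond d (towerP L m (n + 1)) => (1 : 𝔸ˣ)) a' (c₁ := c₁) x⟫_ℂ)
        (M Rr : ℝ) (H : Prop),
      HasMajorant (g := toB6 (towerGeom L m n η M) Rr H) (fun p : TSite d (towerP L m (n + 1)) × ι => blkK L m n p.1)
        (conj b (readA φ (GpOfUk L m n φ η U a' (c₁ := c₁) hposU)) -
          conj b (readA φ (GpOfUk L m n φ η (fun _ : Bond d (towerP L m (n + 1)) => (1 : 𝔸ˣ)) a' (c₁ := c₁) hpos₁)))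
        (fun a a' => BJ * α * Real.exp (-(δJ * (towerGeom L m n η M).dist a a'))) := by
  classical
  have hSb : 0 ≤ ∑ i, ‖b i‖ := Finset.sum_nonneg fun i _ => norm_nonneg _
  have hd0 : (0 : ℝ) < d := by exact_mod_cast hd
  have hL1 : 1 ≤ L := le_trans (by norm_num) hL3
  -- (0) THE THREE THM-3.1 INPUTS AT THE VACUUM, common `(BG, δ₀)` before the height
  obtain ⟨BG, δ₀, hBG, hδ₀, hbase⟩ := exists_hasMajorants_GpOfUk_one L φ (a' := a') hMφ hMφ' hφn hφn' ha' τ hτ₂ hφτ b hM₂ hrepr hd hL3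
  -- (1) THE (3.59) CONSTANT `C_q` before the lattice (window `α ≤ 1/16`, `α₁ = 4α`)
  set ck : ℝ := ((d * (L - 1) : ℕ) : ℝ) * (3 / (1 - r)) with hck
  set cs : ℝ := ((d * (L - 1) : ℕ) : ℝ) * (2 * Mφ * Mφ' / (1 - r)) with hcs
  have h1r : 0 < 1 - r := by linarith
  have hck0 : 0 ≤ ck := by positivity
  have hcs0 : 0 ≤ cs := by positivity
  set Cq : ℝ := (ck * Real.exp (ck * (1 / 16)) + Mφ * Mφ' * (cs * Real.exp (cs * (1 / 16)))) / 4 with hCq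
  have hCq0 : 0 ≤ Cq := by positivity
  -- (2) r06's THEOREM 3.4 AT THE CHAIN's BASE DATA, `a₁`, `B` before the lattice
  obtain ⟨a₁, ha₁, B, hB, hfin⟩ := thm34_Gp_uniform b (Fin d) d δ₀ BG Cq |a'| d M₂ (fun _ => (1 : ℝ)) hBG hCq0 (abs_nonneg _) hM₂ hδ₀
    (fun _ _ => le_rfl) hrepr
  -- (3) the thresholds and the final constants
  set αJ : ℝ := min (1 / 16) (a₁ / 4) with hαJ
  have hαJ0 : 0 < αJ := lt_min (by norm_num) (by positivity)
  set Θ : ℝ := BG * 1 * B6.c1 d δ₀ (1 / 100) * (2 * cVConc (Fintype.card (Fin d)) 1 (4 * αJ) |a'| Cq M₂ (∑ i, ‖b i‖) (Real.exp (δ₀ * d))) with hΘ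
  have hΘ0 : 0 ≤ Θ := by
    have := B9Ineq363Vprime.cVConc_nonneg (d := Fintype.card (Fin d)) (ρu := 1) (α₁ := 4 * αJ) (a₀ := |a'|) (C := Cq) (M₂ := M₂) (Sb := ∑ i, ‖b i‖)
      (E₀ := Real.exp (δ₀ * d)) (by positivity) (abs_nonneg _) hCq0 hM₂ hSb (Real.exp_nonneg _)
    rw [hΘ]; have := B6RandomWalk.c1_nonneg d δ₀ (1 / 100); positivity
  refine ⟨αJ, B * B6.c1 d (9 / 10 * δ₀) (1 / 2) * Θ * 4, 9 / 20 * δ₀, hαJ0, by have := B6RandomWalk.c1_nonneg d (9 / 10 * δ₀) (1 / 2); positivity, by positivity, ?_⟩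
  intro n η hηL c₀ c₁ _ _ hdiag m _ U α hα hαle hUb hUε hgrad εU hεU hεU1 hεg hLε hLb hposU hpos₁ M Rr H
  have hα16 : α ≤ 1 / 16 := hαle.trans (min_le_left _ _)
  have hαa₁ : 4 * α ≤ a₁ := by have := hαle.trans (min_le_right _ _); linarith
  have hLpos : (0 : ℝ) < (L : ℝ) ^ (n + 1) := pow_pos (by exact_mod_cast Nat.pos_of_ne_zero (NeZero.ne L)) _
  have hη : 0 < η := by
    by_contra h; push Not at h; nlinarith [mul_nonpos_of_nonpos_of_nonneg h hLpos.le]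
  have hη1 : η ≤ 1 := by
    have : (1 : ℝ) ≤ (L : ℝ) ^ (n + 1) := one_le_pow₀ (by exact_mod_cast hL1)
    nlinarith
  have hm : ∀ i, 1 ≤ m i := fun i => Nat.one_le_iff_ne_zero.mpr (NeZero.ne (m i))
  -- names
  set g := towerGeom L m n η M with hg
  set Td : Fin d → Equiv.Perm (TSite d (towerP L m (n + 1))) := fun μ => shiftEquiv (Pd := towerP L m (n + 1)) μ with hTd
  set V1 : Bond d (towerP L m (n + 1)) → 𝔸ˣ := fun _ => 1 with hV1
  set Ud1 : Fin d → TSite d (towerP L m (n + 1)) → 𝔸ˣ := fun μ y => V1 (y, μ) with hUd1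
  set A : Fin d → TSite d (towerP L m (n + 1)) → 𝔸 := fun μ y => ((I * η : ℂ))⁻¹ • mlog (U (y, μ) : 𝔸) with hA
  set kQ1 := kQ L m n (fun j => adTransport (𝕜 := ℂ) (UlevOf L m (n + 1) V1 j)) with hkQ1
  set kQU := kQ L m n (fun j => adTransport (𝕜 := ℂ) (UlevOf L m (n + 1) U j)) with hkQU
  set sQ1 := sQ L m n φ V1 (c₀ := c₀) (c₁ := c₁) with hsQ1
  set sQU := sQ L m n φ U (c₀ := c₀) (c₁ := c₁) with hsQU
  set w : TSite d m → ℝ := fun _ => (((L : ℝ) ^ (n + 1)) ^ d)⁻¹ with hw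
  -- geometry facts
  have hlen1 : ∀ y : g.Site, g.len y = 1 := fun y => by
    show (towerGeom L m n η M).len y = 1
    rw [len_towerGeom, mul_comm]; exact hηL
  -- (4) the ∀-block of r06's theorem at the base: inverse pair, Thm-3.1 inputs, letters
  obtain ⟨h342_1, h342_2, h342_3⟩ := hbase n η hηL c₀ c₁ hdiag m hpos₁ M Rr H
  have hinv := conj_readA_GpOfUk_inverse L m n φ η V1 a' hpos₁ b (c₀ := c₀) (c₁ := c₁)
  have hkQ1flat : kQ1 = kQ L m n (fun _ _ => (LinearMap.id : 𝔸 →ₗ[ℂ] 𝔸)) := kQ_flatLevels_eq L m n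
  have hkQ : ∀ y x, blkK L m n x = y → ‖kQ1 y x‖ ≤ w y := fun y x _ => by
    rw [hkQ1flat]; exact norm_kQ_le L m n _ (fun _ _ v => le_rfl) y x
  have hcard : ∀ y, ((B9Eq360Vprime.block (blkK L m n) y).card : ℝ) * w y ≤ 1 := fun y => (card_block_blkK_mul_inv_eq_one L m n y).le
  have hsQ : ∀ x, ‖sQ1 x‖ ≤ 1 := fun x => by
    refine (norm_sQ_one_le L m n φ (c₀ := c₀) (c₁ := c₁) x).trans (le_of_eq ?_)
    have hc₀ : (0 : ℝ) < c₀ := Fact.out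
    rw [← hdiag]; field_simp
  have hcfun : ∀ y : g.Site, |(fun _ : TSite d m => a') y| ≤ |a'| * (g.len y ^ 2)⁻¹ := fun y => by rw [hlen1]; simp
  have hU1base : ∀ μ z, ‖((Ud1 μ z : 𝔸ˣ) : 𝔸)‖ ≤ 1 ∧ ‖(((Ud1 μ z)⁻¹ : 𝔸ˣ) : 𝔸)‖ ≤ 1 := fun μ z => by simp [hUd1, hV1]
  have hfinU := hfin Td Ud1 (g := g) (Rr := Rr) (H := H) (blkK L m n) kQ1 sQ1 (fun _ => a') w (hdnn_towerGeom L m n η M) (htri_towerGeom L m n η M Rr H)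
    (hrefl_towerGeom L m n η M) (hsym_towerGeom L m n η M) (hlen_towerGeom L m n η M hη) (hlenη_towerGeom L m n η M hL1 hη.le) hη
    (h261_towerGeom_R1 L m n η M Rr H hδ₀) (fun α' hα' => hST_towerGeom L m n η M hη.le hδ₀.le α' (by linarith)) hU1base
    (fun μ x => dist_blkK_shift_symm_le L m n η M μ x) (fun μ x => dist_blkK_shift_le L m n η M μ x) (dist_self_le L m n η M hd0.le)
    (fun _ => by positivity) hcard hkQ hsQ hcfun hinv.1 hinv.2 h342_1 h342_2 h342_3 (4 * α) (by positivity) hαa₁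
  -- (5) the (3.37) bounds of the log chart and the (3.59) sizes
  have hUε' : ∀ μ (x : TSite d (towerP L m (n + 1))), ‖((fun μ y => U (y, μ)) μ x : 𝔸) - 1‖ ≤ α * η := fun μ x => hUε (x, μ)
  have hαη : α * η ≤ 1 / 2 := by nlinarith
  obtain ⟨hA0, hAτ, h337F, h337B, h337Bτ⟩ := logChart_bounds_flatBase Td (fun μ y => U (y, μ)) hη hUε' hαη (fun μ ν x => hgrad x μ ν)
  have hexpk : Real.exp (ck * α) - 1 ≤ (ck * Real.exp (ck * (1 / 16))) * α := exp_window_sub_one_le hck0 hα hα16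
  have hexps : Real.exp (cs * α) - 1 ≤ (cs * Real.exp (cs * (1 / 16))) * α := exp_window_sub_one_le hcs0 hα hα16
  have hCq4 : Cq * (4 * α) = (ck * Real.exp (ck * (1 / 16))) * α + Mφ * Mφ' * ((cs * Real.exp (cs * (1 / 16))) * α) := by rw [hCq]; ring
  have hkF : ∀ y x, blkK L m n x = y → ‖(kQU - kQ1) y x‖ ≤ Cq * (4 * α) * w y := by
    intro y x _
    rw [hkQ1flat]
    refine (norm_kF_le_of_class L m n U εU hεU hεU1 hLε hLb hr0 hr1 hα hεg y x).trans ?_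
    have e1 : ((d * (L - 1) : ℕ) : ℝ) * (3 * α / (1 - r)) = ck * α := by rw [hck]; ring
    rw [e1, hCq4]
    refine mul_le_mul_of_nonneg_right (hexpk.trans ?_) (by positivity)
    have : 0 ≤ Mφ * Mφ' * ((cs * Real.exp (cs * (1 / 16))) * α) := by positivity
    linarith
  have hsF : ∀ x, ‖(sQU - sQ1) x‖ ≤ Cq * (4 * α) := by
    intro x
    rw [Pi.sub_apply]
    refine (norm_sF_le_of_class L m n φ U εU hεU hLε hLb hr0 hr1 hα hεg hMφ hMφ' hφn hφn' x).trans ?_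
    have hc₀ : (0 : ℝ) < c₀ := Fact.out
    have e1 : ((d * (L - 1) : ℕ) : ℝ) * (2 * Mφ * Mφ' * α / (1 - r)) = cs * α := by rw [hcs]; ring
    have e2 : c₁ / c₀ * (((L : ℝ) ^ (n + 1)) ^ d)⁻¹ = 1 := by rw [← hdiag]; field_simp
    rw [e1, hCq4]
    calc Mφ * Mφ' * (c₁ / c₀ * ((Real.exp (cs * α) - 1) * (((L : ℝ) ^ (n + 1)) ^ d)⁻¹))
        = Mφ * Mφ' * (Real.exp (cs * α) - 1) * (c₁ / c₀ * (((L : ℝ) ^ (n + 1)) ^ d)⁻¹) := by ring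
      _ = Mφ * Mφ' * (Real.exp (cs * α) - 1) := by rw [e2, mul_one]
      _ ≤ Mφ * Mφ' * ((cs * Real.exp (cs * (1 / 16))) * α) := mul_le_mul_of_nonneg_left hexps (by positivity)
      _ ≤ (ck * Real.exp (ck * (1 / 16))) * α + Mφ * Mφ' * ((cs * Real.exp (cs * (1 / 16))) * α) := by
          have : 0 ≤ (ck * Real.exp (ck * (1 / 16))) * α := by positivity
          linarith
  -- the (3.37) letters in r06's shapes (`len = 1`, `α₁ = 4α`)
  have hlen2i : ∀ x : TSite d (towerP L m (n + 1)), (g.len (blkK L m n x) ^ 2)⁻¹ = 1 := fun x => by rw [hlen1]; norm_num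
  have hleni : ∀ x : TSite d (towerP L m (n + 1)), (g.len (blkK L m n x))⁻¹ = 1 := fun x => by rw [hlen1]; norm_num
  have h337B' : ∀ ν k x, ‖((g.eta : ℂ)⁻¹) • covDstar Td Ud1 ν (A k) x‖ ≤ 4 * α * (g.len (blkK L m n x) ^ 2)⁻¹ := fun ν k x => by
    rw [hlen2i, mul_one]; exact h337B ν k x
  have h337F' : ∀ μ ν x, ‖((g.eta : ℂ)⁻¹) • covD Td Ud1 μ (A ν) x‖ ≤ 4 * α * (g.len (blkK L m n x) ^ 2)⁻¹ := fun μ ν x => by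
    rw [hlen2i, mul_one]; exact h337F μ ν x
  have h337Bτ' : ∀ μ x, ‖((g.eta : ℂ)⁻¹) • covDstar Td Ud1 μ (tauB Td Ud1 μ (A μ)) x‖ ≤ 4 * α * (g.len (blkK L m n x) ^ 2)⁻¹ := fun μ x => by
    rw [hlen2i, mul_one]; exact h337Bτ μ x
  have hA' : ∀ k x, ‖A k x‖ ≤ 4 * α * (g.len (blkK L m n x))⁻¹ := fun k x => by
    rw [hleni, mul_one]; exact (hA0 k x).trans (by linarith)
  have hAτB' : ∀ ν k x, ‖tauB Td Ud1 ν (A k) x‖ ≤ 4 * α * (g.len (blkK L m n x))⁻¹ := fun ν k x => by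
    rw [hleni, mul_one]; exact (hAτ ν k x).trans (by linarith)
  obtain ⟨i1, i2, hLeft, -⟩ := hfinU A (kQU - kQ1) (sQU - sQ1) hkF hsF h337B' h337F' h337Bτ' hA' hAτB'
  clear hfinU hfin hbase
  -- (6) (3.63) at the base for the concrete `V′(A)`: `V′G′(1) ≺ θ₃₆₃(4α)·e^{−0.45δ₀d}`
  have hsmall : ∀ y : g.Site, g.eta * (4 * α * (g.len y)⁻¹) ≤ 1 / 4 := fun y => by
    rw [hlen1, inv_one, mul_one]; show η * (4 * α) ≤ 1 / 4; nlinarith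
  have h363 := ineq363_op_vPrime b Td Ud1 (Rr := Rr) (H := H) (blkK L m n) d (η := g.eta) hη A kQ1 (kQU - kQ1) sQ1 (sQU - sQ1) (fun _ : TSite d m => a') w
    1 d M₂ Cq |a'| δ₀ δ₀ (1 / 100) (1 / 100) (9 / 20 * δ₀) 1 BG (4 * α) hBG.le (by positivity) zero_le_one (by positivity) (by norm_num) (by norm_num)
    hδ₀.le hδ₀.le (by linarith) (hdnn_towerGeom L m n η M) (htri_towerGeom L m n η M Rr H) (hlen_towerGeom L m n η M hη)
    (h261_towerGeom L m n η M Rr H (by norm_num) hδ₀) (hST_towerGeom L m n η M hη.le hδ₀.le (1 / 100) (by norm_num)).1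
    (hST_towerGeom L m n η M hη.le hδ₀.le (1 / 100) (by norm_num)).2.1 hM₂ hrepr hsmall (fun μ x => ⟨hA' μ x, hAτB' μ μ x⟩) (fun μ x => h337B' μ μ x)
    hU1base (fun μ x => ⟨dist_blkK_shift_le L m n η M μ x, dist_blkK_shift_symm_le L m n η M μ x⟩) (dist_self_le L m n η M hd0.le)
    (fun _ => by positivity) hcard hCq0 (abs_nonneg _) hkQ hkF hsQ hsF hcfun h342_1 h342_2
  -- (7) `E ≺ B·len²·e^{−0.9δ₀d}` (left clause at `X = 1`)
  have hE1 := hLeft 1 (fun a => g.len a ^ 2) (fun _ => sq_nonneg _) (by rw [one_mul]; exact h342_1)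
  rw [one_mul] at hE1
  -- (8) THE LAW: `Δp − V′ = conj b (readA Δ′_k(U))`, hence `E = conj b (readA G′_k(U))`
  have hU1lt : ∀ μ (x : TSite d (towerP L m (n + 1))), ‖((fun μ y => U (y, μ)) μ x : 𝔸) - 1‖ < 1 := fun μ x =>
    (hUε (x, μ)).trans_lt (by nlinarith)
  have hUV : (fun μ y => U (y, μ)) = prodCfg Ud1 η A := (prodCfg_one_logChart (fun μ y => U (y, μ)) hη hU1lt).symm
  have hlaw := conj_readA_law L m n φ η U a' b V1 hη.ne' A hUV (c₀ := c₀) (c₁ := c₁)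
  have hEeq := eq_conj_readA_GpOfUk_of_inverse L m n φ η U a' hposU b (c₀ := c₀) (c₁ := c₁) _ (by rw [hlaw]; exact i1)
  clear hLeft h342_2 h342_3 hkF hsF h337B' h337F' h337Bτ' hA' hAτB' hlaw hUV hU1lt hsmall
  -- (9) abstract the four operators and do the (3.65) algebra: `G′(U) − G′(1) = G′(U)·(V′G′(1))`
  generalize hGp : conj b (readA φ (GpOfUk L m n φ η V1 a' (c₁ := c₁) hpos₁)) = Gp at i1 i2 hE1 h363 hEeq hinv ⊢
  generalize hΔp : conj b (readA φ (laplacePrimeAk L m n φ η V1 a' (c₀ := c₀) (c₁ := c₁))) = Δp at i1 i2 hinv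
  generalize hVc : conj b (vPrimeConc Td Ud1 g.eta A (blkK L m n) kQ1 (kQU - kQ1) sQ1 (sQU - sQ1) (fun _ : TSite d m => a')) = Vc at i1 i2 hE1 h363 hEeq
  generalize hE : gPrimeExtEnd Gp (Vc * Gp) = E at i1 i2 hE1 hEeq
  have hdiff : conj b (readA φ (GpOfUk L m n φ η U a' (c₁ := c₁) hposU)) - Gp = E * (Vc * Gp) := by
    rw [← hEeq]
    have h1 : E * (Vc * Gp) = E * (Δp * Gp) - (E * (Δp - Vc)) * Gp := by
      rw [mul_sub, sub_mul, ← mul_assoc, ← mul_assoc, sub_sub_cancel]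
    rw [h1, hinv.1, i2, mul_one, one_mul]
  -- (10) the product by [4] (2.66) and the «O(1)α₁»
  have hθ : theta363 (Fintype.card (Fin d)) 1 (4 * α) |a'| Cq M₂ (∑ i, ‖b i‖) (Real.exp (δ₀ * d)) BG 1 (B6.c1 d δ₀ (1 / 100)) ≤ Θ * (4 * α) := by
    rw [hΘ]
    exact theta363_le_linear (by positivity) (by linarith [hαle.trans (min_le_left _ _), hαJ0]) (abs_nonneg _) hCq0 hM₂ hSb (Real.exp_nonneg _) hBG.le zero_le_one
      (B6RandomWalk.c1_nonneg d δ₀ (1 / 100))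
  have hθ0 : 0 ≤ theta363 (Fintype.card (Fin d)) 1 (4 * α) |a'| Cq M₂ (∑ i, ‖b i‖) (Real.exp (δ₀ * d)) BG 1 (B6.c1 d δ₀ (1 / 100)) :=
    B9Ineq363Vprime.theta363_nonneg (by positivity) (abs_nonneg _) hCq0 hM₂ hSb (Real.exp_nonneg _) hBG.le zero_le_one (B6RandomWalk.c1_nonneg d δ₀ (1 / 100))
  have hT : HasMajorant (g := toB6 g Rr H) (fun p : TSite d (towerP L m (n + 1)) × ι => blkK L m n p.1) (Vc * Gp)
      (fun a a'' => theta363 (Fintype.card (Fin d)) 1 (4 * α) |a'| Cq M₂ (∑ i, ‖b i‖) (Real.exp (δ₀ * d)) BG 1 (B6.c1 d δ₀ (1 / 100)) *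
        Real.exp (-((1 - 1 / 2) * (9 / 10 * δ₀) * g.dist a a''))) :=
    hasMajorant_mono _ h363 fun a a'' => by rw [show ((1 : ℝ) - 1 / 2) * (9 / 10 * δ₀) = 9 / 20 * δ₀ by ring]
  have hprod := majorant_G0_mul_265 (g := toB6 g Rr H) (fun p : TSite d (towerP L m (n + 1)) × ι => blkK L m n p.1) d (9 / 10 * δ₀) (1 / 2) B
    (theta363 (Fintype.card (Fin d)) 1 (4 * α) |a'| Cq M₂ (∑ i, ‖b i‖) (Real.exp (δ₀ * d)) BG 1 (B6.c1 d δ₀ (1 / 100))) (fun a => g.len a ^ 2)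
    hB (fun _ => sq_nonneg _) hθ0 (by positivity) (htri_towerGeom L m n η M Rr H) (h261_towerGeom L m n η M Rr H (by norm_num) (by positivity)) hE1 hT
  rw [hdiff]
  refine hasMajorant_mono _ hprod fun a a'' => ?_
  rw [hlen1, one_pow, mul_one]
  have hc1' : 0 ≤ B6.c1 d (9 / 10 * δ₀) (1 / 2) := B6RandomWalk.c1_nonneg d _ _
  calc B * B6.c1 d (9 / 10 * δ₀) (1 / 2) * theta363 (Fintype.card (Fin d)) 1 (4 * α) |a'| Cq M₂ (∑ i, ‖b i‖) (Real.exp (δ₀ * d)) BG 1 (B6.c1 d δ₀ (1 / 100)) *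
        Real.exp (-((1 - 1 / 2) * (9 / 10 * δ₀) * g.dist a a''))
      ≤ B * B6.c1 d (9 / 10 * δ₀) (1 / 2) * (Θ * (4 * α)) * Real.exp (-((1 - 1 / 2) * (9 / 10 * δ₀) * g.dist a a'')) := by gcongr
    _ = B * B6.c1 d (9 / 10 * δ₀) (1 / 2) * Θ * 4 * α * Real.exp (-(9 / 20 * δ₀ * g.dist a a'')) := by ring_nf

end Main

end Literature.MathematicalPhysics.QuantumFieldTheory.Balaban1983to89.B9Thm34TowerVacuumLadder

end
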